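import Literature.MathematicalPhysics.QuantumFieldTheory.Balaban1983to89.B6ScalarFactorsChartV1
import Literature.MathematicalPhysics.QuantumFieldTheory.Balaban1983to89.B6AgreeLapV1Chart
import HarnessLib

/-!
# [B6] Prop. 2.6, line 3 of (2.92): the scalar factors of `T_□` AGREE with those of `T_η` through the window chart —
the mixed ring data `χ·Δ′·G̃′_□ = χ = G̃′_□·Δ′·χ`, `S̃_□·G′²·S = S̃_□`, `G̃′_□S̃_□·G̃′_□²·S = G̃′_□·S` ACROSS the identification `T_□ = □̃³ ⊂ T_η`

statement-level skeleton of published theorems with citation tags; proofs where landed; nothing here is a claim about the Yang–Mills mass gap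

[tag: formalized_from_source] (the algebra is ours; the identification *"We take the cube □̃³ and identify it with a torus, denoted
by T_□, imposing periodicity conditions. On this torus we define operators R, Δ_a as in (2.17), (2.19), but only two scales are
present now. We define B^j(Λ) = □̃² ∩ B^{j+1}(Λ_{j+1}), (2.89)"* is [cite: Balaban1984PropagatorsII, p.238–239]; OUR GLOSS of it, used
below without quotation marks: inside the window the member's levels `Ω_j` are the global ones (note print's (2.89) is written with `□̃²`).)

## What this file is for

`B6ScalarFactorsChartV1` builds, on ONE V1 torus (global `T_η` over `(hN, D)`, or a member `T_□` over `(hN₁, D₁)`), the scalar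
factors of line 3 of (2.92): `Δ′ = DpV`, `G′ = GpV = Δ′⁻¹`, `S = SV = Q′*(Q′G′²Q′*)⁻¹Q′`, with `P = I − R = G′SG′` and the
one-carrier ring data `G′Δ′ = Δ′G′ = 1`, `S·G′²·S = S`.  p38's domain-change algebra for `ζ_□(∂P∂* − ∂P_□∂*)h_□`
(`B6DomainChangeP2134`, sandwich form) works in the ONE ring `End(T_η-site functions)`, where the member's factors enter
TRANSPLANTED through r03's bijective site window chart `cS t x₀ hx₀ hfit` (`B6AgreeLapV1Chart`; `ε∘T′∘ρ` of
`B6Prop26ReachTransplant.transplant`): `G̃′_□ := εG′_□ρ`, `S̃_□ := εS_□ρ`, `P̃_□ = G̃′_□S̃_□G̃′_□`.  It consumes the MIXED identities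

* `χ·Δ′·G̃′_□ = χ`, `G̃′_□·Δ′·χ = χ` for cut-offs `χ` supported deep inside the window (the global `Δ′_a` IS the member's `Δ′_a`
  near `□` — (2.13)–(2.14) are local stencils plus block averages over blocks aligned with the window);
* `hS1 : S̃_□·(G′G′)·S = S̃_□` and `hS2 : G̃′_□S̃_□·(G̃′_□G̃′_□)·S = G̃′_□·S` (both averaging operators see the same blocks).

This file proves them (§4–§5) from a KERNEL AGREEMENT `KAgree cS cS ((c′/c)²) (Δ′_{T_η}) (Δ′_{T_□})` on the sites of margin `3`
(§3; the Laplacian part is r03's `∂*∘∂` composition `kagree_dsE ∘ kagree_dE`, the averaging part is the block-label translation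
`x ↦ x − x₀` under the alignment `L^{k₁} ∣ x₀`), generic passages KAgree ⇒ ring identities (§1), and the block correspondence of
the window (§5: global blocks meeting the window are whole, and are exactly the member's blocks).

## Hypotheses relating the two families (discharged by the cube-window construction, r03's `B6CubeWindowV1`/p22's `famOf`)

* `hlevW : ∀ x ∈ DeepS t x₀ 0, D₁.lev (toBox hN₁ (eS t x₀ x)) = D.lev (toBox hN x)` — the member's level function is the
  global one read through the chart (our gloss of p. 239, (2.89) *"B^j(Λ) = □̃² ∩ B^{j+1}(Λ_{j+1})"*);
* `hal : ∀ μ, L^{k₁} ∣ x₀ μ` (the window corner is a vertex of the block lattices of all member levels `≤ k₁`) and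
  `hk₁ : k₁ ≤ m_□ + K_□` (those block sizes divide the member's period `2L^{m_□+K_□}`).

No measure, no Yang–Mills claim.
-/

open scoped Matrix BigOperators
open Finset

namespace Literature.MathematicalPhysics.QuantumFieldTheory.Balaban1983to89.B6ScalarAgreeV1Chart

open B4Reflection242 (boxDom mem_boxDom blk avgK)
open B6MultiLevelBoxOperator (N0 aPrinted levC)
open B6MultiLevelTorusOperator (TDomains perLapT mlOpT mlOpT_apply mlOpT_isSymm)
open B6Geom246MultiLevelBox (bset blkOf blkOf_val exists_blkOf_eq blkOf_eq_iff_blk)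
open B6Ineq268MultiLevelBox (W W_pos)
open B6Ineq2133TwoScaleV1 (onFun onFun_apply)
open B6SectAOperatorsV1 (ScalarSpace dE dsE lapE)
open B6GlobalChartV1 (PV toBox toBox_apply toBox_injective toBox_surjective boxEquiv boxEquiv_apply)
open B6ScalarChartV1 (boxEquiv_symm_toBox toBox_boxEquiv_symm sum_toBox lapE_chart)
open B6Ineq288MultiLevelTorus (GT dP QsM QM GiM GiM_mul)
open B6ScalarFactorsChartV1 (chartOp chartOp_apply chartOp_comp_symm chartOp_mul chartOp_one chartOp_add chartOp_smul chartOp_sub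
  onFun_eq_chartOp DpV GpV SV GpV_mul_DpV DpV_mul_GpV SV_mul_GpV_sq_mul_SV)
open B6Prop26Gluing (mulOp mulOp_apply)
open B6Prop26ReachTransplant (restrictOp extendOp transplant restrictOp_apply_of_injOn extendOp_apply transplant_apply
  restrictOp_extendOp_of_bij transplant_mul_of_bij transplant_one_mul_mulOp sitesPerDir_zero)
open B6Prop25TwoScaleCensus (TSIdx)
open B6AgreeLapV1Chart (WChart KAgree KLocal apply_eq_sum_toMatrix onFun_comp eS DeepS DeepB deepS_mono val_eS eS_surj
  cS mem_cS_W cS_e kagree_dE kagree_dsE klocal_dE)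

/-! ## §1  From kernel agreement to ring identities (generic bijective window chart) -/

section RingIdentities

variable {X X' : Type} [Fintype X] [DecidableEq X] [Fintype X'] [DecidableEq X']

/-- **`(εG′ρ)·T·χ = s•χ`**: if the global `T` agrees with the local `T′` (factor `s`) on the deep inputs `R ⊂` window and `G′T′ = 1` on the
local carrier, then the transplanted inverse inverts `T` on cut-offs supported in `R` — the typed content of `G_□·(Δ_a)_□ = 1` read near `□`.
[cite: Balaban1984PropagatorsII, (2.90)–(2.91) p.239, p.238 (T_□); derivation ours] -/
theorem transplant_mul_mul_mulOp_of_kagree {c : WChart X X'} {s : ℝ} {T : Module.End ℝ (X → ℝ)} {T' G' : Module.End ℝ (X' → ℝ)}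
    {R : Set X} (h : KAgree c c s T T' R) (hR : R ⊆ ↑c.W) (hGT : G' * T' = 1) (χ : X → ℝ) (hχ : ∀ x, χ x ≠ 0 → x ∈ R) :
    transplant c.W c.e G' * T * mulOp χ = s • mulOp χ := by
  rw [mul_assoc, h.mul_mulOp hR χ hχ, mul_smul_comm, ← mul_assoc, ← transplant_mul_of_bij c.inj c.surj, hGT,
    transplant_one_mul_mulOp c.inj χ fun x hx => Finset.mem_coe.1 (hR (hχ x hx))]

/-- for SYMMETRIC kernels column agreement on `R` is row agreement on `R`. [cite: Balaban1984PropagatorsII, p.238–239 (T_□), dictionary] -/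
theorem rows_of_kagree_symm {c : WChart X X'} {s : ℝ} {T : Module.End ℝ (X → ℝ)} {T' : Module.End ℝ (X' → ℝ)} {R : Set X}
    (h : KAgree c c s T T' R) (hT : (LinearMap.toMatrix' T).IsSymm) (hT' : (LinearMap.toMatrix' T').IsSymm) {y : X} (hy : y ∈ R)
    (x : X) : LinearMap.toMatrix' T y x = s * (if x ∈ c.W then LinearMap.toMatrix' T' (c.e y) (c.e x) else 0) := by
  rw [hT.apply x y, h y hy x, hT'.apply (c.e y) (c.e x)]

/-- **`χ·T·(εG′ρ) = s•χ`**: the mirror identity (symmetric kernels, `T′G′ = 1`). [cite: Balaban1984PropagatorsII, (2.90)–(2.91) p.239, p.238 (T_□); derivation ours] -/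
theorem mulOp_mul_mul_transplant_of_kagree {c : WChart X X'} {s : ℝ} {T : Module.End ℝ (X → ℝ)} {T' G' : Module.End ℝ (X' → ℝ)}
    {R : Set X} (h : KAgree c c s T T' R) (hR : R ⊆ ↑c.W) (hT : (LinearMap.toMatrix' T).IsSymm)
    (hT' : (LinearMap.toMatrix' T').IsSymm) (hTG : T' * G' = 1) (χ : X → ℝ) (hχ : ∀ x, χ x ≠ 0 → x ∈ R) :
    mulOp χ * T * transplant c.W c.e G' = s • mulOp χ := by
  apply LinearMap.ext
  intro f
  funext y
  rw [Module.End.mul_apply, Module.End.mul_apply, mulOp_apply, LinearMap.smul_apply, Pi.smul_apply, mulOp_apply, smul_eq_mul]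
  by_cases hy : χ y = 0
  · rw [hy, zero_mul, zero_mul, mul_zero]
  have hyR : y ∈ R := hχ y hy
  have hyW : y ∈ c.W := Finset.mem_coe.1 (hR hyR)
  have hsum : T (transplant c.W c.e G' f) y = s * ((T' * G') (restrictOp c.W c.e f)) (c.e y) := by
    rw [Module.End.mul_apply, apply_eq_sum_toMatrix T (transplant c.W c.e G' f) y,
      apply_eq_sum_toMatrix T' (G' (restrictOp c.W c.e f)) (c.e y), c.sum_eq, Finset.mul_sum,
      ← Finset.sum_subset (Finset.subset_univ c.W)]
    · refine Finset.sum_congr rfl fun x hx => ?_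
      rw [rows_of_kagree_symm h hT hT' hyR x, if_pos hx, transplant_apply, if_pos hx]
      ring
    · intro x _ hx
      rw [transplant_apply, if_neg hx, mul_zero]
  rw [hsum, hTG, Module.End.one_apply, restrictOp_apply_of_injOn c.inj f hyW]
  ring

end RingIdentities

/-! ## §2  Kernels of charted torus matrices; `Δ′ = c²(−Δ^{per}) + averaging part` on the V1 site functions -/

section Kernels

variable {d ℓ : ℕ} {m K : ℕ} {hd : 1 ≤ d + 1} {hL : Odd (ℓ + 1) ∧ 1 < ℓ + 1} {Mh k R : ℕ} {P' : Fin (d + 1) → ℕ}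
variable (hN : ∀ μ, N0 ℓ Mh k P' μ = (PV d ℓ m K hd hL).sitesPerDir 0) (D : TDomains d ℓ Mh k P' R)

/-- **the kernel of a charted torus matrix IS the matrix**: `mat(M̂)(y, x) = M(toBox y, toBox x)`. [cite: Balaban1984PropagatorsII, (2.150) p.249 (operators as kernels), (2.1) p.224, dictionary] -/
theorem toMatrix'_chartOp (M : Matrix ↥(boxDom (N0 ℓ Mh k P')) ↥(boxDom (N0 ℓ Mh k P')) ℝ) (y x : Site (PV d ℓ m K hd hL) 0) :
    LinearMap.toMatrix' (chartOp hN M) y x = M (toBox hN y) (toBox hN x) := by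
  classical
  have h : (fun z => (Pi.single x (1 : ℝ) : Site (PV d ℓ m K hd hL) 0 → ℝ) ((boxEquiv hN).symm z)) =
      Pi.single (toBox hN x) (1 : ℝ) := by
    funext z
    simp only [Pi.single_apply, Equiv.symm_apply_eq, boxEquiv_apply]
  rw [LinearMap.toMatrix'_apply, chartOp_apply, h, Matrix.mulVec_single_one]
  rfl

/-- a symmetric torus matrix has a symmetric charted kernel. [cite: Balaban1984PropagatorsII, (2.13)–(2.14) p.225 (a quadratic form), dictionary] -/
theorem isSymm_toMatrix'_chartOp {M : Matrix ↥(boxDom (N0 ℓ Mh k P')) ↥(boxDom (N0 ℓ Mh k P')) ℝ} (hM : M.IsSymm) (a : ℝ) :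
    (LinearMap.toMatrix' (a • chartOp hN M)).IsSymm := by
  refine Matrix.IsSymm.ext fun y x => ?_
  rw [map_smul, Matrix.smul_apply, Matrix.smul_apply, toMatrix'_chartOp, toMatrix'_chartOp, hM.apply]

/-- the kernel of `Δ′ = DpV` is symmetric. [cite: Balaban1984PropagatorsII, (2.13)–(2.14) p.225] -/
theorem isSymm_toMatrix'_DpV (c : ℝ) : (LinearMap.toMatrix' (DpV hN D c)).IsSymm :=
  isSymm_toMatrix'_chartOp hN (mlOpT_isSymm ℓ k D.lev (aPrinted ℓ 1)) (c ^ 2)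

/-- **V1's `−c²Δ` (`lapE c = ∂*∂`) IS the charted `c²·(−Δ^{per})`** as an operator on site functions (gen 19's `lapE_chart`, pointwise).
[cite: Balaban1984PropagatorsII, (2.13) p.225 («Δ … on T_η»); Balaban1984PropagatorsI, (1.21) p.21] -/
theorem onFun_lapE_eq (c : ℝ) : onFun (lapE (P := PV d ℓ m K hd hL) c) = c ^ 2 • chartOp hN (perLapT (N0 ℓ Mh k P')) := by
  rw [← chartOp_smul]
  refine onFun_eq_chartOp hN fun f x => ?_
  have hf : WithLp.toLp 2 (fun x' : Site (PV d ℓ m K hd hL) 0 => (fun z => f ((boxEquiv hN).symm z)) (toBox hN x')) = f :=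
    PiLp.ext fun x' => congrArg f (boxEquiv_symm_toBox hN x')
  rw [Matrix.smul_mulVec, Pi.smul_apply, smul_eq_mul, ← lapE_chart hN c _ x, hf]

/-- **`Δ′ = (−c²Δ) + c²·(averaging part)`** on the V1 site functions: `DpV = onFun (lapE c) + c²·(Δ′_a − (−Δ^{per}))^`.
[cite: Balaban1984PropagatorsII, (2.13)–(2.14) p.225] -/
theorem DpV_eq_lapE_add (c : ℝ) :
    DpV hN D c = onFun (lapE (P := PV d ℓ m K hd hL) c) + c ^ 2 • chartOp hN (dP D - perLapT (N0 ℓ Mh k P')) := by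
  rw [onFun_lapE_eq hN, ← smul_add, ← chartOp_add, add_sub_cancel]
  rfl

/-- **the kernel of the averaging part**: `c²·levC_{lev y}·[x ∼_{lev y} y]` (same `L^{lev y}`-block).
[cite: Balaban1984PropagatorsII, (2.13)–(2.14) p.225] -/
theorem toMatrix'_avgPart (c : ℝ) (y x : Site (PV d ℓ m K hd hL) 0) :
    LinearMap.toMatrix' (c ^ 2 • chartOp hN (dP D - perLapT (N0 ℓ Mh k P'))) y x =
      c ^ 2 * avgK (levC d ℓ (aPrinted ℓ 1) (D.lev (toBox hN y : Fin (d + 1) → ℤ))) ((ℓ + 1) ^ D.lev (toBox hN y : Fin (d + 1) → ℤ))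
        (toBox hN y : Fin (d + 1) → ℤ) (toBox hN x : Fin (d + 1) → ℤ) := by
  rw [map_smul, Matrix.smul_apply, smul_eq_mul, toMatrix'_chartOp, Matrix.sub_apply]
  simp only [dP]
  rw [mlOpT_apply D rfl, add_sub_cancel_left]

/-- values of `S = SV`: `(Sf)(x) = c⁴·(G̃·Q′f̂)(y(x))` — a function of the BLOCK of `x` only. [cite: Balaban1984PropagatorsII, (2.17) p.225, (2.86) p.238] -/
theorem SV_apply (c : ℝ) (f : Site (PV d ℓ m K hd hL) 0 → ℝ) (x : Site (PV d ℓ m K hd hL) 0) :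
    SV hN D c f x = c ^ 4 * (GiM D *ᵥ (QM D *ᵥ fun z => f ((boxEquiv hN).symm z))) (blkOf D.toDomains (toBox hN x)) := by
  show (c ^ 4 • chartOp hN (QsM D * GiM D * QM D)) f x = _
  rw [LinearMap.smul_apply, Pi.smul_apply, smul_eq_mul, chartOp_apply, ← Matrix.mulVec_mulVec, ← Matrix.mulVec_mulVec, QsM_mulVec]
where
  /-- `(Q′*v)(x) = v(y(x))`. -/
  QsM_mulVec (v : ↥(bset D.toDomains) → ℝ) (z : ↥(boxDom (N0 ℓ Mh k P'))) : (QsM D *ᵥ v) z = v (blkOf D.toDomains z) := by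
    classical
    simp only [Matrix.mulVec, dotProduct, QsM, ite_mul, one_mul, zero_mul, Finset.sum_ite_eq, Finset.mem_univ, if_true]

/-- `(Q′*v)(x) = v(y(x))` (block-constant extension). [cite: Balaban1984PropagatorsII, (2.16)–(2.17) p.225, dictionary] -/
theorem QsM_mulVec_apply (v : ↥(bset D.toDomains) → ℝ) (z : ↥(boxDom (N0 ℓ Mh k P'))) :
    (QsM D *ᵥ v) z = v (blkOf D.toDomains z) := by
  classical
  simp only [Matrix.mulVec, dotProduct, QsM, ite_mul, one_mul, zero_mul, Finset.sum_ite_eq, Finset.mem_univ, if_true]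

/-- `(Q′f)(y) = W(y)⁻¹·Σ_{x ∈ y} f(x)` (normalised block average). [cite: Balaban1984PropagatorsII, (2.16) p.225, dictionary] -/
theorem QM_mulVec_apply (f : ↥(boxDom (N0 ℓ Mh k P')) → ℝ) (y : ↥(bset D.toDomains)) :
    (QM D *ᵥ f) y = (W D.toDomains y)⁻¹ * ∑ z, if blkOf D.toDomains z = y then f z else 0 := by
  classical
  simp only [Matrix.mulVec, dotProduct, QM, ite_mul, zero_mul, Finset.mul_sum, mul_ite, mul_zero]

/-- **`S` is block-constant in the output**: `y(x) = y(x′) ⇒ (Sf)(x) = (Sf)(x′)`. [cite: Balaban1984PropagatorsII, (2.17) p.225 («Q′*»)] -/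
theorem SV_apply_eq_of_blkOf_eq (c : ℝ) (f : Site (PV d ℓ m K hd hL) 0 → ℝ) {x x' : Site (PV d ℓ m K hd hL) 0}
    (h : blkOf D.toDomains (toBox hN x) = blkOf D.toDomains (toBox hN x')) : SV hN D c f x = SV hN D c f x' := by
  rw [SV_apply, SV_apply, h]

/-- **`Sg = 0 ⇒ Q′ĝ = 0`** (all normalised block averages of `g` vanish): `S = Q′*G̃Q′` with `Q′*` injective on block vectors and `G̃` invertible.
[cite: Balaban1984PropagatorsII, (2.17) p.225, Prop. 2.3 p.238 («an inverse of the operator Q′G′²Q′*»)] -/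
theorem QM_mulVec_eq_zero_of_SV_eq_zero (hℓ : 1 ≤ ℓ) (hMh : 1 ≤ Mh) (hP : ∀ μ, 1 ≤ P' μ) {c : ℝ} (hc : c ≠ 0)
    {g : Site (PV d ℓ m K hd hL) 0 → ℝ} (hg : SV hN D c g = 0) :
    QM D *ᵥ (fun z => g ((boxEquiv hN).symm z)) = 0 := by
  have hv : GiM D *ᵥ (QM D *ᵥ fun z => g ((boxEquiv hN).symm z)) = 0 := by
    funext y
    obtain ⟨z, hz⟩ := exists_blkOf_eq D.toDomains y
    have hx := congrFun hg ((boxEquiv hN).symm z)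
    rw [SV_apply, toBox_boxEquiv_symm, hz, Pi.zero_apply] at hx
    exact (mul_eq_zero.1 hx).resolve_left (pow_ne_zero 4 hc)
  have h2 := (GiM_mul D hℓ hMh hP).2
  calc QM D *ᵥ (fun z => g ((boxEquiv hN).symm z))
      = ((QM D * GT D * GT D * QsM D) * GiM D) *ᵥ (QM D *ᵥ fun z => g ((boxEquiv hN).symm z)) := by rw [h2, Matrix.one_mulVec]
    _ = 0 := by rw [← Matrix.mulVec_mulVec, hv, Matrix.mulVec_zero]

/-- **`S·G′²` FIXES BLOCK-CONSTANT FUNCTIONS**: `v = Q′*w ⇒ (Q′*G̃Q′·G′G′)v = v` (`G̃·(Q′G′²Q′*) = 1`).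
[cite: Balaban1984PropagatorsII, (2.17) p.225, Prop. 2.3 p.238] -/
theorem SGG_mulVec_of_blockConst (hℓ : 1 ≤ ℓ) (hMh : 1 ≤ Mh) (hP : ∀ μ, 1 ≤ P' μ) {v : ↥(boxDom (N0 ℓ Mh k P')) → ℝ}
    (hv : ∀ z z', blkOf D.toDomains z = blkOf D.toDomains z' → v z = v z') :
    (QsM D * GiM D * QM D * (GT D * GT D)) *ᵥ v = v := by
  classical
  -- `v = Q′*w` with `w(y) := v(any site of y)`
  have hw : v = QsM D *ᵥ fun y => v (Classical.choose (exists_blkOf_eq D.toDomains y)) := by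
    funext z
    rw [QsM_mulVec_apply]
    exact hv _ _ (Classical.choose_spec (exists_blkOf_eq D.toDomains (blkOf D.toDomains z))).symm
  have h1 := (GiM_mul D hℓ hMh hP).1
  have key : QsM D * GiM D * QM D * (GT D * GT D) * QsM D = QsM D :=
    calc QsM D * GiM D * QM D * (GT D * GT D) * QsM D = QsM D * (GiM D * (QM D * GT D * GT D * QsM D)) := by
          simp only [Matrix.mul_assoc]
      _ = QsM D := by rw [h1, Matrix.mul_one]
  conv_lhs => rw [hw, Matrix.mulVec_mulVec, key]
  exact hw.symm

/-- **`S·G′G′·u = u` for `u` block-constant** (V1 site functions). [cite: Balaban1984PropagatorsII, (2.17) p.225, Prop. 2.3 p.238] -/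
theorem SV_GpV_GpV_apply_of_blockConst (hℓ : 1 ≤ ℓ) (hMh : 1 ≤ Mh) (hP : ∀ μ, 1 ≤ P' μ) {c : ℝ} (hc : c ≠ 0)
    {u : Site (PV d ℓ m K hd hL) 0 → ℝ}
    (hu : ∀ x x', blkOf D.toDomains (toBox hN x) = blkOf D.toDomains (toBox hN x') → u x = u x') :
    SV hN D c (GpV hN D c (GpV hN D c u)) = u := by
  have hop : SV hN D c * (GpV hN D c * GpV hN D c) = chartOp hN (QsM D * GiM D * QM D * (GT D * GT D)) := by
    show (c ^ 4 • chartOp hN (QsM D * GiM D * QM D)) * ((c ^ 2)⁻¹ • chartOp hN (GT D) * ((c ^ 2)⁻¹ • chartOp hN (GT D))) = _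
    rw [smul_mul_smul_comm, smul_mul_smul_comm, ← chartOp_mul, ← chartOp_mul]
    have hc2 : c ^ 2 ≠ 0 := pow_ne_zero 2 hc
    have e : c ^ 4 * ((c ^ 2)⁻¹ * (c ^ 2)⁻¹) = 1 := by field_simp
    rw [e, one_smul]
  have h := congrArg (fun T : Module.End ℝ (Site (PV d ℓ m K hd hL) 0 → ℝ) => T u) hop
  simp only [Module.End.mul_apply] at h
  rw [h]
  funext x
  rw [chartOp_apply, SGG_mulVec_of_blockConst D hℓ hMh hP, boxEquiv_symm_toBox]
  intro z z' hzz'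
  have := hu ((boxEquiv hN).symm z) ((boxEquiv hN).symm z')
  rw [toBox_boxEquiv_symm, toBox_boxEquiv_symm] at this
  exact this hzz'

end Kernels

/-! ## §3  The window: label translation, aligned blocks, and the kernel agreement of `Δ′` -/

section Window

variable {d ℓ : ℕ} {m K : ℕ} {hd : 1 ≤ d + 1} {hL : Odd (ℓ + 1) ∧ 1 < ℓ + 1} {Mh k R : ℕ} {P' : Fin (d + 1) → ℕ}
variable (hN : ∀ μ, N0 ℓ Mh k P' μ = (PV d ℓ m K hd hL).sitesPerDir 0) (D : TDomains d ℓ Mh k P' R)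
variable {a₀ a₁ : ℝ} {t : TSIdx d (ℓ + 1) hd hL a₀ a₁} {x₀ : Fin (d + 1) → ℤ}
variable {hx₀ : ∀ μ, 0 ≤ x₀ μ} {hfit : ∀ μ, x₀ μ + (t.P.sitesPerDir 0 : ℕ) ≤ ((PV d ℓ m K hd hL).sitesPerDir 0 : ℕ)}
variable {Mh₁ k₁ R₁ : ℕ} {P₁ : Fin (d + 1) → ℕ}
variable (hN₁ : ∀ μ, N0 ℓ Mh₁ k₁ P₁ μ = (PV d ℓ t.m t.K hd hL).sitesPerDir 0) (D₁ : TDomains d ℓ Mh₁ k₁ P₁ R₁)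

/-- **labels through the site chart**: `toBox(e x) = toBox(x) − x₀` on the window. [cite: Balaban1984PropagatorsII, p.238 (T_□), dictionary] -/
theorem toBox_eS_eq {x : Site (PV d ℓ m K hd hL) 0} (hx : x ∈ DeepS t x₀ 0) :
    (toBox hN₁ (eS t x₀ x) : Fin (d + 1) → ℤ) = (toBox hN x : Fin (d + 1) → ℤ) - x₀ := by
  funext μ
  rw [Pi.sub_apply, toBox_apply, toBox_apply]
  exact val_eS hx μ

omit hN D hN₁ D₁ in
/-- block labels of a translate by a vector of the block lattice: `blk_s(z − a) = blk_s(z) − blk_s(a)` for `s ∣ a` (label arithmetic of the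
identification `□̃³ ⊂ T_η ↔ T_□`). [cite: Balaban1984PropagatorsII, p.238 (T_□ = □̃³), (2.1) p.224, dictionary] -/
theorem blk_sub_eq {s : ℕ} {a : Fin (d + 1) → ℤ} (ha : ∀ μ, (s : ℤ) ∣ a μ) (z : Fin (d + 1) → ℤ) :
    blk s (z - a) = blk s z - blk s a := by
  funext μ
  simp only [blk, Pi.sub_apply]
  obtain ⟨q, hq⟩ := ha μ
  rw [hq]
  rcases eq_or_ne (s : ℤ) 0 with hs | hs
  · simp [hs]
  · rw [Int.mul_ediv_cancel_left q hs, show z μ - (s : ℤ) * q = z μ + (-q) * s by ring, Int.add_mul_ediv_right _ _ hs]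
    ring

/-- **block labels correspond through the chart** when the corner lies on the block lattice (`s ∣ x₀`).
[cite: Balaban1984PropagatorsII, p.238–239 (T_□, (2.89)), dictionary] -/
theorem blk_eS_eq_iff {s : ℕ} (hal : ∀ μ, (s : ℤ) ∣ x₀ μ) {x x' : Site (PV d ℓ m K hd hL) 0} (hx : x ∈ DeepS t x₀ 0)
    (hx' : x' ∈ DeepS t x₀ 0) :
    blk s (toBox hN₁ (eS t x₀ x) : Fin (d + 1) → ℤ) = blk s (toBox hN₁ (eS t x₀ x') : Fin (d + 1) → ℤ) ↔
      blk s (toBox hN x : Fin (d + 1) → ℤ) = blk s (toBox hN x' : Fin (d + 1) → ℤ) := by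
  rw [toBox_eS_eq hN hN₁ hx, toBox_eS_eq hN hN₁ hx', blk_sub_eq hal, blk_sub_eq hal, sub_left_inj]

omit hN₁ D₁ in
/-- **ALIGNED BLOCKS MEETING THE WINDOW ARE WHOLE**: if `L^j` divides the corner and the member period (`j ≤ m_□ + K_□`), the `L^j`-block of a
window site lies in the window. [cite: Balaban1984PropagatorsII, p.238 (□̃³ a union of blocks), dictionary] -/
theorem mem_deepS_of_blk_eq {j : ℕ} (hj : j ≤ t.m + t.K) (hal : ∀ μ, (((ℓ + 1) ^ j : ℕ) : ℤ) ∣ x₀ μ)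
    {x y : Site (PV d ℓ m K hd hL) 0} (hx : x ∈ DeepS t x₀ 0)
    (h : blk ((ℓ + 1) ^ j) (toBox hN y : Fin (d + 1) → ℤ) = blk ((ℓ + 1) ^ j) (toBox hN x : Fin (d + 1) → ℤ)) :
    y ∈ DeepS t x₀ 0 := by
  intro μ
  have hμ : ((y μ).val : ℤ) / (((ℓ + 1) ^ j : ℕ) : ℤ) = ((x μ).val : ℤ) / (((ℓ + 1) ^ j : ℕ) : ℤ) := by
    have := congrFun h μ
    simpa only [blk, toBox_apply] using this
  obtain ⟨h1, h2⟩ := hx μ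
  obtain ⟨q, hq⟩ := hal μ
  set s : ℤ := (((ℓ + 1) ^ j : ℕ) : ℤ) with hs_def
  have hs : 0 < s := by rw [hs_def]; positivity
  obtain ⟨n, hn⟩ : ∃ n : ℤ, ((t.P.sitesPerDir 0 : ℕ) : ℤ) = s * n := by
    refine ⟨(2 * (ℓ + 1) ^ (t.m + t.K - j) : ℕ), ?_⟩
    rw [sitesPerDir_zero t, hs_def]
    have e : t.m + t.K = j + (t.m + t.K - j) := by omega
    conv_lhs => rw [e, pow_add]
    push_cast
    ring
  simp only [Nat.cast_zero, add_zero] at h1 h2 ⊢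
  have hq1 : q ≤ ((x μ).val : ℤ) / s := (Int.le_ediv_iff_mul_le hs).2 (by linarith)
  have hq2 : ((x μ).val : ℤ) / s < q + n := (Int.ediv_lt_iff_lt_mul hs).2 (by linarith)
  rw [← hμ] at hq1 hq2
  have hy1 := (Int.le_ediv_iff_mul_le hs).1 hq1
  have hy2 := (Int.ediv_lt_iff_lt_mul hs).1 hq2
  constructor <;> linarith

/-- a window site in the same `L^{lev y}`-block as `y` forces `y` into the window, when the window's levels are `≤ k₁` (through `hlevW`) and
`L^{k₁}` divides the corner. [cite: Balaban1984PropagatorsII, (2.1) p.224 (Ω_j unions of blocks), p.238–239, dictionary] -/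
theorem mem_deepS_of_blk_lev_eq (hlevW : ∀ x ∈ DeepS t x₀ 0, D₁.lev (toBox hN₁ (eS t x₀ x) : Fin (d + 1) → ℤ) = D.lev (toBox hN x))
    (hal : ∀ μ, (((ℓ + 1) ^ k₁ : ℕ) : ℤ) ∣ x₀ μ) (hk₁ : k₁ ≤ t.m + t.K) {x y : Site (PV d ℓ m K hd hL) 0} (hx : x ∈ DeepS t x₀ 0)
    (h : blk ((ℓ + 1) ^ D.lev (toBox hN y : Fin (d + 1) → ℤ)) (toBox hN x : Fin (d + 1) → ℤ) =
      blk ((ℓ + 1) ^ D.lev (toBox hN y : Fin (d + 1) → ℤ)) (toBox hN y : Fin (d + 1) → ℤ)) :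
    y ∈ DeepS t x₀ 0 := by
  have hlev : D.lev (toBox hN x : Fin (d + 1) → ℤ) = D.lev (toBox hN y : Fin (d + 1) → ℤ) :=
    D.toDomains.lev_eq_of_blk_eq (toBox hN y).2 (toBox hN x).2 h
  have hj : D.lev (toBox hN y : Fin (d + 1) → ℤ) ≤ k₁ := by
    rw [← hlev, ← hlevW x hx]
    exact D₁.lev_le _
  refine mem_deepS_of_blk_eq hN (le_trans hj hk₁) (fun μ => ?_) hx h.symm
  exact (Int.natCast_dvd_natCast.2 (Nat.pow_dvd_pow _ hj)).trans (hal μ)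

/-- **KERNEL AGREEMENT OF THE AVERAGING PARTS** `c′²(Δ′_a − (−Δ))` of `T_η` and `c²(Δ′_a − (−Δ))` of `T_□` on the whole window, factor `(c′/c)²`:
both are `levC_{lev}·[same L^{lev}-block]`, the levels agree through the chart (`hlevW`) and the blocks correspond (`hal`).
[cite: Balaban1984PropagatorsII, (2.13)–(2.14) p.225, p.238–239 (T_□, (2.89)); gloss ours] -/
theorem kagree_avgPart (hlevW : ∀ x ∈ DeepS t x₀ 0, D₁.lev (toBox hN₁ (eS t x₀ x) : Fin (d + 1) → ℤ) = D.lev (toBox hN x))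
    (hal : ∀ μ, (((ℓ + 1) ^ k₁ : ℕ) : ℤ) ∣ x₀ μ) (hk₁ : k₁ ≤ t.m + t.K) (c' : ℝ) {c : ℝ} (hc : c ≠ 0) :
    KAgree (cS t x₀ hx₀ hfit) (cS t x₀ hx₀ hfit) ((c' / c) ^ 2) (c' ^ 2 • chartOp hN (dP D - perLapT (N0 ℓ Mh k P')))
      (c ^ 2 • chartOp hN₁ (dP D₁ - perLapT (N0 ℓ Mh₁ k₁ P₁))) (DeepS t x₀ 0) := by
  intro x hx y
  rw [toMatrix'_avgPart]
  by_cases hy : y ∈ (cS t x₀ hx₀ hfit).W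
  · have hyD : y ∈ DeepS t x₀ 0 := mem_cS_W.1 hy
    rw [if_pos hy, cS_e, toMatrix'_avgPart, hlevW y hyD]
    have hj : D.lev (toBox hN y : Fin (d + 1) → ℤ) ≤ k₁ := by rw [← hlevW y hyD]; exact D₁.lev_le _
    have hdiv : ∀ μ, (((ℓ + 1) ^ D.lev (toBox hN y : Fin (d + 1) → ℤ) : ℕ) : ℤ) ∣ x₀ μ := fun μ =>
      (Int.natCast_dvd_natCast.2 (Nat.pow_dvd_pow _ hj)).trans (hal μ)
    have e : ∀ a : ℝ, c' ^ 2 * a = (c' / c) ^ 2 * (c ^ 2 * a) := fun a => by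
      rw [div_pow, div_mul_eq_mul_div, mul_div_assoc, mul_div_cancel_left₀ a (pow_ne_zero 2 hc)]
    simp only [avgK]
    rw [if_congr (blk_eS_eq_iff hN hN₁ hdiv hx hyD) rfl rfl]
    split_ifs
    · exact e _
    · exact e _
  · rw [if_neg hy, mul_zero]
    simp only [avgK]
    rw [if_neg fun hblk => hy (mem_cS_W.2 (mem_deepS_of_blk_lev_eq hN D hN₁ D₁ hlevW hal hk₁ hx hblk)), mul_zero]

/-- **KERNEL AGREEMENT OF THE LAPLACIAN PARTS** `∂*∂` (factor `c′` on `T_η`, `c` on `T_□`) on the sites of margin `3`, factor `(c′/c)²` — r03's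
`kagree_dsE ∘ kagree_dE`. [cite: Balaban1984PropagatorsII, (2.7)–(2.8) p.224, p.239 (operators on T_□ «as in (2.19)»), (2.94) p.239] -/
theorem kagree_lapE {c' : ℝ} (hc' : c' ≠ 0) {c : ℝ} (hc : c ≠ 0) :
    KAgree (cS t x₀ hx₀ hfit) (cS t x₀ hx₀ hfit) ((c' / c) ^ 2) (onFun (lapE (P := PV d ℓ m K hd hL) c'))
      (onFun (lapE (P := t.P) c)) (DeepS t x₀ 3) := by
  rw [sq]
  show KAgree _ _ _ (onFun (dsE c' ∘ₗ dE c')) (onFun (dsE c ∘ₗ dE c)) _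
  rw [onFun_comp, onFun_comp]
  exact KAgree.comp ((kagree_dE c' hc).mono (deepS_mono (by omega))) (div_ne_zero hc' hc) (klocal_dE hx₀ c' 2)
    (kagree_dsE c' hc)

/-- **KERNEL AGREEMENT OF `Δ′_a`** of `T_η` (fine factor `c′`) and of `T_□` (fine factor `c`) through the site window chart on the sites of
margin `3`, factor `(c′/c)²` — *"On this torus we define operators R, Δ_a as in (2.17), (2.19), but only two scales are present now"* (p. 239)
read for the scalar `Δ′_a` of (2.13) (gloss ours: inside the window the levels are the global ones). [cite: Balaban1984PropagatorsII, (2.13)–(2.14) p.225, p.238–239, (2.94) p.239] -/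
theorem kagree_DpV (hlevW : ∀ x ∈ DeepS t x₀ 0, D₁.lev (toBox hN₁ (eS t x₀ x) : Fin (d + 1) → ℤ) = D.lev (toBox hN x))
    (hal : ∀ μ, (((ℓ + 1) ^ k₁ : ℕ) : ℤ) ∣ x₀ μ) (hk₁ : k₁ ≤ t.m + t.K) {c' : ℝ} (hc' : c' ≠ 0) {c : ℝ} (hc : c ≠ 0) :
    KAgree (cS t x₀ hx₀ hfit) (cS t x₀ hx₀ hfit) ((c' / c) ^ 2) (DpV hN D c') (DpV hN₁ D₁ c) (DeepS t x₀ 3) := by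
  rw [DpV_eq_lapE_add hN D c', DpV_eq_lapE_add hN₁ D₁ c]
  exact (kagree_lapE hc' hc).add ((kagree_avgPart hN D hN₁ D₁ hlevW hal hk₁ c' hc).mono (deepS_mono (by omega)))

end Window

/-! ## §4  The mixed ring data `χ·Δ′·G̃′_□ = χ = G̃′_□·Δ′·χ` (same fine factor on both carriers) -/

section Ring

variable {d ℓ : ℕ} {m K : ℕ} {hd : 1 ≤ d + 1} {hL : Odd (ℓ + 1) ∧ 1 < ℓ + 1} {Mh k R : ℕ} {P' : Fin (d + 1) → ℕ}
variable (hN : ∀ μ, N0 ℓ Mh k P' μ = (PV d ℓ m K hd hL).sitesPerDir 0) (D : TDomains d ℓ Mh k P' R)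
variable {a₀ a₁ : ℝ} {t : TSIdx d (ℓ + 1) hd hL a₀ a₁} {x₀ : Fin (d + 1) → ℤ}
variable (hx₀ : ∀ μ, 0 ≤ x₀ μ) (hfit : ∀ μ, x₀ μ + (t.P.sitesPerDir 0 : ℕ) ≤ ((PV d ℓ m K hd hL).sitesPerDir 0 : ℕ))
variable {Mh₁ k₁ R₁ : ℕ} {P₁ : Fin (d + 1) → ℕ}
variable (hN₁ : ∀ μ, N0 ℓ Mh₁ k₁ P₁ μ = (PV d ℓ t.m t.K hd hL).sitesPerDir 0) (D₁ : TDomains d ℓ Mh₁ k₁ P₁ R₁)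

omit hN D hN₁ D₁ in
/-- the deep sites lie in the window. [cite: Balaban1984PropagatorsII, p.238 (□̃ ⊂ □̃³), dictionary] -/
theorem deepS_subset_W (r : ℕ) : DeepS (m := m) (K := K) t x₀ r ⊆ ((cS t x₀ hx₀ hfit).W : Set (Site (PV d ℓ m K hd hL) 0)) :=
  fun _ hx => Finset.mem_coe.2 (mem_cS_W.2 (deepS_mono (Nat.zero_le r) hx))

/-- **`G̃′_□·Δ′·χ = χ`**: the transplanted member inverse `εG′_□ρ` inverts the GLOBAL `Δ′_a` on cut-offs supported on the sites of margin `3` of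
the window (p38's ring datum `Gw·D·χ = χ`). [cite: Balaban1984PropagatorsII, p.225 («G′ = Δ′_a^{−1}»), (2.90)–(2.91) p.239, p.238 (T_□); derivation ours] -/
theorem transplantGpV_mul_DpV_mul_mulOp
    (hlevW : ∀ x ∈ DeepS t x₀ 0, D₁.lev (toBox hN₁ (eS t x₀ x) : Fin (d + 1) → ℤ) = D.lev (toBox hN x))
    (hal : ∀ μ, (((ℓ + 1) ^ k₁ : ℕ) : ℤ) ∣ x₀ μ) (hk₁ : k₁ ≤ t.m + t.K) (hℓ : 1 ≤ ℓ) (hMh₁ : 1 ≤ Mh₁) (hP₁ : ∀ μ, 1 ≤ P₁ μ)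
    {c : ℝ} (hc : c ≠ 0) (χ : Site (PV d ℓ m K hd hL) 0 → ℝ) (hχ : ∀ x, χ x ≠ 0 → x ∈ DeepS t x₀ 3) :
    transplant (cS t x₀ hx₀ hfit).W (eS t x₀) (GpV hN₁ D₁ c) * DpV hN D c * mulOp χ = mulOp χ := by
  have h := kagree_DpV hN D hN₁ D₁ (hx₀ := hx₀) (hfit := hfit) hlevW hal hk₁ hc hc
  rw [div_self hc, one_pow] at h
  have := transplant_mul_mul_mulOp_of_kagree h (deepS_subset_W hx₀ hfit 3) (GpV_mul_DpV hN₁ D₁ hℓ hMh₁ hP₁ hc) χ hχ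
  rwa [one_smul] at this

/-- **`χ·Δ′·G̃′_□ = χ`** (p38's ring datum `χ·D·Gw = χ`). [cite: Balaban1984PropagatorsII, p.225 («G′ = Δ′_a^{−1}»), (2.90)–(2.91) p.239, p.238 (T_□); derivation ours] -/
theorem mulOp_mul_DpV_mul_transplantGpV
    (hlevW : ∀ x ∈ DeepS t x₀ 0, D₁.lev (toBox hN₁ (eS t x₀ x) : Fin (d + 1) → ℤ) = D.lev (toBox hN x))
    (hal : ∀ μ, (((ℓ + 1) ^ k₁ : ℕ) : ℤ) ∣ x₀ μ) (hk₁ : k₁ ≤ t.m + t.K) (hℓ : 1 ≤ ℓ) (hMh₁ : 1 ≤ Mh₁) (hP₁ : ∀ μ, 1 ≤ P₁ μ)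
    {c : ℝ} (hc : c ≠ 0) (χ : Site (PV d ℓ m K hd hL) 0 → ℝ) (hχ : ∀ x, χ x ≠ 0 → x ∈ DeepS t x₀ 3) :
    mulOp χ * DpV hN D c * transplant (cS t x₀ hx₀ hfit).W (eS t x₀) (GpV hN₁ D₁ c) = mulOp χ := by
  have h := kagree_DpV hN D hN₁ D₁ (hx₀ := hx₀) (hfit := hfit) hlevW hal hk₁ hc hc
  rw [div_self hc, one_pow] at h
  have := mulOp_mul_mul_transplant_of_kagree h (deepS_subset_W hx₀ hfit 3) (isSymm_toMatrix'_DpV hN D c)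
    (isSymm_toMatrix'_DpV hN₁ D₁ c) (DpV_mul_GpV hN₁ D₁ hℓ hMh₁ hP₁ hc) χ hχ
  rwa [one_smul] at this

end Ring

/-! ## §5  The block correspondence of the window and `hS1`, `hS2`, `P̃_□ = G̃′_□S̃_□G̃′_□` -/

section Blocks

variable {d ℓ : ℕ} {m K : ℕ} {hd : 1 ≤ d + 1} {hL : Odd (ℓ + 1) ∧ 1 < ℓ + 1} {Mh k R : ℕ} {P' : Fin (d + 1) → ℕ}
variable (hN : ∀ μ, N0 ℓ Mh k P' μ = (PV d ℓ m K hd hL).sitesPerDir 0) (D : TDomains d ℓ Mh k P' R)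
variable {a₀ a₁ : ℝ} {t : TSIdx d (ℓ + 1) hd hL a₀ a₁} {x₀ : Fin (d + 1) → ℤ}
variable (hx₀ : ∀ μ, 0 ≤ x₀ μ) (hfit : ∀ μ, x₀ μ + (t.P.sitesPerDir 0 : ℕ) ≤ ((PV d ℓ m K hd hL).sitesPerDir 0 : ℕ))
variable {Mh₁ k₁ R₁ : ℕ} {P₁ : Fin (d + 1) → ℕ}
variable (hN₁ : ∀ μ, N0 ℓ Mh₁ k₁ P₁ μ = (PV d ℓ t.m t.K hd hL).sitesPerDir 0) (D₁ : TDomains d ℓ Mh₁ k₁ P₁ R₁)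

omit D hx₀ hfit D₁ in
/-- every point of the member's fundamental box is the charted image of a window site. [cite: Balaban1984PropagatorsII, p.238 (T_□ = □̃³), dictionary] -/
theorem exists_window_preimage (hx₀ : ∀ μ, 0 ≤ x₀ μ)
    (hfit : ∀ μ, x₀ μ + (t.P.sitesPerDir 0 : ℕ) ≤ ((PV d ℓ m K hd hL).sitesPerDir 0 : ℕ)) (z : ↥(boxDom (N0 ℓ Mh₁ k₁ P₁))) :
    ∃ x ∈ DeepS (m := m) (K := K) t x₀ 0, toBox hN₁ (eS t x₀ x) = z := by
  obtain ⟨x₁, hx₁⟩ := toBox_surjective hN₁ z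
  obtain ⟨x, hx, hxe⟩ := eS_surj (m := m) (K := K) hx₀ hfit x₁
  exact ⟨x, hx, by rw [hxe, hx₁]⟩

omit hx₀ hfit in
/-- **THE WINDOW'S BLOCKS ARE THE MEMBER'S BLOCKS**: for window sites, same member block through the chart iff same global block.
[cite: Balaban1984PropagatorsII, p.238–239 (T_□, (2.89)), dictionary] -/
theorem blkOf_eS_eq_iff (hlevW : ∀ x ∈ DeepS t x₀ 0, D₁.lev (toBox hN₁ (eS t x₀ x) : Fin (d + 1) → ℤ) = D.lev (toBox hN x))
    (hal : ∀ μ, (((ℓ + 1) ^ k₁ : ℕ) : ℤ) ∣ x₀ μ) {x x' : Site (PV d ℓ m K hd hL) 0} (hx : x ∈ DeepS t x₀ 0)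
    (hx' : x' ∈ DeepS t x₀ 0) :
    blkOf D₁.toDomains (toBox hN₁ (eS t x₀ x)) = blkOf D₁.toDomains (toBox hN₁ (eS t x₀ x')) ↔
      blkOf D.toDomains (toBox hN x) = blkOf D.toDomains (toBox hN x') := by
  have hj : D.lev (toBox hN x : Fin (d + 1) → ℤ) ≤ k₁ := by rw [← hlevW x hx]; exact D₁.lev_le _
  have hdiv : ∀ μ, (((ℓ + 1) ^ D.lev (toBox hN x : Fin (d + 1) → ℤ) : ℕ) : ℤ) ∣ x₀ μ := fun μ =>
    (Int.natCast_dvd_natCast.2 (Nat.pow_dvd_pow _ hj)).trans (hal μ)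
  rw [Subtype.ext_iff, Subtype.ext_iff, blkOf_val, blkOf_val, blkOf_val, blkOf_val, Prod.mk.injEq, Prod.mk.injEq]
  simp only [TDomains.toDomains_lev]
  rw [hlevW x hx, hlevW x' hx']
  constructor
  · rintro ⟨hl, hb⟩
    refine ⟨hl, ?_⟩
    rw [← hl] at hb ⊢
    exact (blk_eS_eq_iff hN hN₁ hdiv hx hx').1 hb
  · rintro ⟨hl, hb⟩
    refine ⟨hl, ?_⟩
    rw [← hl] at hb ⊢
    exact (blk_eS_eq_iff hN hN₁ hdiv hx hx').2 hb

omit hx₀ hfit hN₁ D₁ in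
/-- **GLOBAL BLOCKS MEETING THE WINDOW ARE WHOLE** (levels `≤ k₁` on the window, `L^{k₁} ∣ x₀`, `k₁ ≤ m_□ + K_□`).
[cite: Balaban1984PropagatorsII, p.238 (□̃³ a union of big blocks), dictionary] -/
theorem mem_deepS_of_blkOf_eq (hN₁ : ∀ μ, N0 ℓ Mh₁ k₁ P₁ μ = (PV d ℓ t.m t.K hd hL).sitesPerDir 0) (D₁ : TDomains d ℓ Mh₁ k₁ P₁ R₁)
    (hlevW : ∀ x ∈ DeepS t x₀ 0, D₁.lev (toBox hN₁ (eS t x₀ x) : Fin (d + 1) → ℤ) = D.lev (toBox hN x))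
    (hal : ∀ μ, (((ℓ + 1) ^ k₁ : ℕ) : ℤ) ∣ x₀ μ) (hk₁ : k₁ ≤ t.m + t.K) {x y : Site (PV d ℓ m K hd hL) 0} (hx : x ∈ DeepS t x₀ 0)
    (h : blkOf D.toDomains (toBox hN y) = blkOf D.toDomains (toBox hN x)) : y ∈ DeepS t x₀ 0 := by
  have hb := (blkOf_eq_iff_blk (D := D.toDomains)).1 h
  simp only [blkOf_val, TDomains.toDomains_lev] at hb
  have hj : D.lev (toBox hN x : Fin (d + 1) → ℤ) ≤ k₁ := by rw [← hlevW x hx]; exact D₁.lev_le _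
  refine mem_deepS_of_blk_eq hN (le_trans hj hk₁) (fun μ => ?_) hx hb
  exact (Int.natCast_dvd_natCast.2 (Nat.pow_dvd_pow _ hj)).trans (hal μ)

/-- **vanishing global block averages restrict to vanishing member block averages**: `Q′ĝ = 0 ⇒ Q′_□(ρg)^ = 0`.
[cite: Balaban1984PropagatorsII, (2.16)–(2.17) p.225, p.238–239 (T_□, (2.89)); derivation ours] -/
theorem QM_member_eq_zero
    (hlevW : ∀ x ∈ DeepS t x₀ 0, D₁.lev (toBox hN₁ (eS t x₀ x) : Fin (d + 1) → ℤ) = D.lev (toBox hN x))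
    (hal : ∀ μ, (((ℓ + 1) ^ k₁ : ℕ) : ℤ) ∣ x₀ μ) (hk₁ : k₁ ≤ t.m + t.K) {g : Site (PV d ℓ m K hd hL) 0 → ℝ}
    (hg : QM D *ᵥ (fun z => g ((boxEquiv hN).symm z)) = 0) :
    QM D₁ *ᵥ (fun z => restrictOp (cS t x₀ hx₀ hfit).W (eS t x₀) g ((boxEquiv hN₁).symm z)) = 0 := by
  classical
  have hinj := (cS t x₀ hx₀ hfit).inj
  simp only [cS_e] at hinj
  funext y₁
  rw [QM_mulVec_apply, Pi.zero_apply]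
  -- a window site charted into the block `y₁`
  obtain ⟨z₁, hz₁⟩ := exists_blkOf_eq D₁.toDomains y₁
  obtain ⟨xs, hxs, hxz⟩ := exists_window_preimage hN₁ hx₀ hfit z₁
  have hxsW : xs ∈ (cS t x₀ hx₀ hfit).W := mem_cS_W.2 hxs
  -- the member block sum is the global block sum of the block of `xs`
  have hsum : (∑ z, if blkOf D₁.toDomains z = y₁ then restrictOp (cS t x₀ hx₀ hfit).W (eS t x₀) g ((boxEquiv hN₁).symm z) else 0) =
      ∑ z, if blkOf D.toDomains z = blkOf D.toDomains (toBox hN xs) then g ((boxEquiv hN).symm z) else 0 := by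
    rw [← sum_toBox hN₁, ← sum_toBox hN, (cS t x₀ hx₀ hfit).sum_eq, ← Finset.sum_subset (Finset.subset_univ (cS t x₀ hx₀ hfit).W)]
    · refine Finset.sum_congr rfl fun x hx => ?_
      have hxD : x ∈ DeepS t x₀ 0 := mem_cS_W.1 hx
      rw [cS_e, boxEquiv_symm_toBox, boxEquiv_symm_toBox, restrictOp_apply_of_injOn hinj g hx, ← hz₁, ← hxz]
      exact if_congr (blkOf_eS_eq_iff hN D hN₁ D₁ hlevW hal hxD hxs) rfl rfl
    · intro x _ hx
      rw [boxEquiv_symm_toBox, if_neg]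
      intro hb
      exact hx (mem_cS_W.2 (mem_deepS_of_blkOf_eq hN D hN₁ D₁ hlevW hal hk₁ hxs hb))
  have hglob := congrFun hg (blkOf D.toDomains (toBox hN xs))
  rw [QM_mulVec_apply, Pi.zero_apply] at hglob
  have hS : (∑ z, if blkOf D.toDomains z = blkOf D.toDomains (toBox hN xs) then g ((boxEquiv hN).symm z) else 0) = 0 := by
    rcases mul_eq_zero.1 hglob with h | h
    · exact absurd h (inv_ne_zero (W_pos _ _).ne')
    · exact h
  rw [hsum, hS, mul_zero]

/-- **`S̃_□·g = 0` whenever `Sg = 0`** (`g` with vanishing global block averages is killed by the transplanted member `S_□`).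
[cite: Balaban1984PropagatorsII, (2.17) p.225, p.238–239; derivation ours] -/
theorem transplantSV_apply_eq_zero
    (hlevW : ∀ x ∈ DeepS t x₀ 0, D₁.lev (toBox hN₁ (eS t x₀ x) : Fin (d + 1) → ℤ) = D.lev (toBox hN x))
    (hal : ∀ μ, (((ℓ + 1) ^ k₁ : ℕ) : ℤ) ∣ x₀ μ) (hk₁ : k₁ ≤ t.m + t.K) (hℓ : 1 ≤ ℓ) (hMh : 1 ≤ Mh) (hP : ∀ μ, 1 ≤ P' μ)
    {c : ℝ} (hc : c ≠ 0) (c₁ : ℝ) {g : Site (PV d ℓ m K hd hL) 0 → ℝ} (hg : SV hN D c g = 0) :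
    transplant (cS t x₀ hx₀ hfit).W (eS t x₀) (SV hN₁ D₁ c₁) g = 0 := by
  have hQ := QM_member_eq_zero hN D hx₀ hfit hN₁ D₁ hlevW hal hk₁ (QM_mulVec_eq_zero_of_SV_eq_zero hN D hℓ hMh hP hc hg)
  funext x
  rw [transplant_apply, Pi.zero_apply]
  split_ifs with hx
  · show (c₁ ^ 4 • chartOp hN₁ (QsM D₁ * GiM D₁ * QM D₁)) _ _ = 0
    rw [LinearMap.smul_apply, Pi.smul_apply, smul_eq_mul, chartOp_apply, ← Matrix.mulVec_mulVec, ← Matrix.mulVec_mulVec, hQ,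
      Matrix.mulVec_zero, Matrix.mulVec_zero, Pi.zero_apply, mul_zero]
  · rfl

/-- **hS1 : `S̃_□·(G′G′)·S = S̃_□`** — p38's first sandwich inverse hypothesis ACROSS the window (`S·G′²·S = S` on `T_η` puts `G′²Sf − f` in
`ker S = {Q′· = 0}`, whose window restriction lies in `ker S_□`). [cite: Balaban1984PropagatorsII, (2.17) p.225, Prop. 2.3 p.238, p.238–239 (T_□); derivation ours] -/
theorem hS1_window
    (hlevW : ∀ x ∈ DeepS t x₀ 0, D₁.lev (toBox hN₁ (eS t x₀ x) : Fin (d + 1) → ℤ) = D.lev (toBox hN x))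
    (hal : ∀ μ, (((ℓ + 1) ^ k₁ : ℕ) : ℤ) ∣ x₀ μ) (hk₁ : k₁ ≤ t.m + t.K) (hℓ : 1 ≤ ℓ) (hMh : 1 ≤ Mh) (hP : ∀ μ, 1 ≤ P' μ)
    {c : ℝ} (hc : c ≠ 0) (c₁ : ℝ) :
    transplant (cS t x₀ hx₀ hfit).W (eS t x₀) (SV hN₁ D₁ c₁) * (GpV hN D c * GpV hN D c) * SV hN D c =
      transplant (cS t x₀ hx₀ hfit).W (eS t x₀) (SV hN₁ D₁ c₁) := by
  apply LinearMap.ext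
  intro f
  rw [Module.End.mul_apply, Module.End.mul_apply, ← sub_eq_zero, ← map_sub]
  refine transplantSV_apply_eq_zero hN D hx₀ hfit hN₁ D₁ hlevW hal hk₁ hℓ hMh hP hc c₁ ?_
  rw [map_sub, sub_eq_zero, ← Module.End.mul_apply, ← Module.End.mul_apply, SV_mul_GpV_sq_mul_SV hN D hℓ hMh hP hc]

/-- **hS2 : `G̃′_□S̃_□·(G̃′_□G̃′_□)·S = G̃′_□·S`** — p38's second sandwich hypothesis ACROSS the window (`Sf` is block-constant, its restriction is
block-constant on `T_□`, and `S_□G′_□²` fixes block-constant functions). [cite: Balaban1984PropagatorsII, (2.17) p.225, Prop. 2.3 p.238, p.238–239 (T_□); derivation ours] -/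
theorem hS2_window
    (hlevW : ∀ x ∈ DeepS t x₀ 0, D₁.lev (toBox hN₁ (eS t x₀ x) : Fin (d + 1) → ℤ) = D.lev (toBox hN x))
    (hal : ∀ μ, (((ℓ + 1) ^ k₁ : ℕ) : ℤ) ∣ x₀ μ) (hℓ : 1 ≤ ℓ) (hMh₁ : 1 ≤ Mh₁) (hP₁ : ∀ μ, 1 ≤ P₁ μ) {c₁ : ℝ} (hc₁ : c₁ ≠ 0) (c : ℝ) :
    transplant (cS t x₀ hx₀ hfit).W (eS t x₀) (GpV hN₁ D₁ c₁) * transplant (cS t x₀ hx₀ hfit).W (eS t x₀) (SV hN₁ D₁ c₁) *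
        (transplant (cS t x₀ hx₀ hfit).W (eS t x₀) (GpV hN₁ D₁ c₁) * transplant (cS t x₀ hx₀ hfit).W (eS t x₀) (GpV hN₁ D₁ c₁)) *
        SV hN D c =
      transplant (cS t x₀ hx₀ hfit).W (eS t x₀) (GpV hN₁ D₁ c₁) * SV hN D c := by
  have hinj := (cS t x₀ hx₀ hfit).inj
  have hsurj := (cS t x₀ hx₀ hfit).surj
  simp only [cS_e] at hinj hsurj
  rw [← transplant_mul_of_bij hinj hsurj, ← transplant_mul_of_bij hinj hsurj, ← transplant_mul_of_bij hinj hsurj]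
  apply LinearMap.ext
  intro f
  rw [Module.End.mul_apply, Module.End.mul_apply]
  funext x
  rw [transplant_apply, transplant_apply]
  split_ifs with hx
  · simp only [Module.End.mul_apply]
    -- the restriction of the block-constant `Sf` is block-constant on `T_□`, hence fixed by `S_□G′_□²`
    have hfix : SV hN₁ D₁ c₁ (GpV hN₁ D₁ c₁ (GpV hN₁ D₁ c₁ (restrictOp (cS t x₀ hx₀ hfit).W (eS t x₀) (SV hN D c f)))) =
        restrictOp (cS t x₀ hx₀ hfit).W (eS t x₀) (SV hN D c f) := by
      refine SV_GpV_GpV_apply_of_blockConst hN₁ D₁ hℓ hMh₁ hP₁ hc₁ fun x₁ x₁' h₁ => ?_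
      obtain ⟨y, hy, hyx⟩ := exists_window_preimage hN₁ hx₀ hfit (toBox hN₁ x₁)
      obtain ⟨y', hy', hyx'⟩ := exists_window_preimage hN₁ hx₀ hfit (toBox hN₁ x₁')
      have e1 : eS t x₀ y = x₁ := toBox_injective hN₁ hyx
      have e2 : eS t x₀ y' = x₁' := toBox_injective hN₁ hyx'
      rw [← e1, ← e2] at h₁ ⊢
      rw [restrictOp_apply_of_injOn hinj _ (mem_cS_W.2 hy), restrictOp_apply_of_injOn hinj _ (mem_cS_W.2 hy')]
      exact SV_apply_eq_of_blkOf_eq hN D c f ((blkOf_eS_eq_iff hN D hN₁ D₁ hlevW hal hy hy').1 h₁)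
    rw [hfix]
  · rfl

/-- **`P̃_□ = G̃′_□S̃_□G̃′_□`**: the transplant of the member's five-factor operator `P_□ = G′_□S_□G′_□` is the product of the transplanted factors
(bijective window). [cite: Balaban1984PropagatorsII, (2.17) p.225, (2.90) p.239, p.238 (T_□)] -/
theorem transplant_GSG (c₁ : ℝ) :
    transplant (cS t x₀ hx₀ hfit).W (eS t x₀) (GpV hN₁ D₁ c₁ * SV hN₁ D₁ c₁ * GpV hN₁ D₁ c₁) =
      transplant (cS t x₀ hx₀ hfit).W (eS t x₀) (GpV hN₁ D₁ c₁) * transplant (cS t x₀ hx₀ hfit).W (eS t x₀) (SV hN₁ D₁ c₁) *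
        transplant (cS t x₀ hx₀ hfit).W (eS t x₀) (GpV hN₁ D₁ c₁) := by
  have hinj := (cS t x₀ hx₀ hfit).inj
  have hsurj := (cS t x₀ hx₀ hfit).surj
  simp only [cS_e] at hinj hsurj
  rw [transplant_mul_of_bij hinj hsurj, transplant_mul_of_bij hinj hsurj]

/-- **THE RING DATA OF LINE 3, PACKAGED** (same fine factor `c` on both carriers): with `Δ′ := DpV`, `G′ := GpV`, `S := SV` of `T_η` and
`G̃′_□ := εG′_□ρ`, `S̃_□ := εS_□ρ` of the member through the site window chart — `G′Δ′ = 1 = Δ′G′`, `χΔ′G̃′_□ = χ = G̃′_□Δ′χ` (supp χ of margin 3),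
`S̃_□G′²S = S̃_□`, `G̃′_□S̃_□G̃′_□²S = G̃′_□S`, `P̃_□ = G̃′_□S̃_□G̃′_□` — the inverse/agreement hypotheses of p38's `B6DomainChangeP2134` sandwich algebra
for `ζ_□(∂P∂* − ∂P_□∂*)h_□`. [cite: Balaban1984PropagatorsII, (2.92) p.239 line 3, (2.17) p.225, p.238–239 (T_□); derivation ours] -/
theorem ringData_window
    (hlevW : ∀ x ∈ DeepS t x₀ 0, D₁.lev (toBox hN₁ (eS t x₀ x) : Fin (d + 1) → ℤ) = D.lev (toBox hN x))
    (hal : ∀ μ, (((ℓ + 1) ^ k₁ : ℕ) : ℤ) ∣ x₀ μ) (hk₁ : k₁ ≤ t.m + t.K) (hℓ : 1 ≤ ℓ) (hMh : 1 ≤ Mh) (hP : ∀ μ, 1 ≤ P' μ)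
    (hMh₁ : 1 ≤ Mh₁) (hP₁ : ∀ μ, 1 ≤ P₁ μ) {c : ℝ} (hc : c ≠ 0) (χ : Site (PV d ℓ m K hd hL) 0 → ℝ)
    (hχ : ∀ x, χ x ≠ 0 → x ∈ DeepS t x₀ 3) :
    GpV hN D c * DpV hN D c = 1 ∧ DpV hN D c * GpV hN D c = 1 ∧
    mulOp χ * DpV hN D c * transplant (cS t x₀ hx₀ hfit).W (eS t x₀) (GpV hN₁ D₁ c) = mulOp χ ∧
    transplant (cS t x₀ hx₀ hfit).W (eS t x₀) (GpV hN₁ D₁ c) * DpV hN D c * mulOp χ = mulOp χ ∧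
    transplant (cS t x₀ hx₀ hfit).W (eS t x₀) (SV hN₁ D₁ c) * (GpV hN D c * GpV hN D c) * SV hN D c =
      transplant (cS t x₀ hx₀ hfit).W (eS t x₀) (SV hN₁ D₁ c) ∧
    transplant (cS t x₀ hx₀ hfit).W (eS t x₀) (GpV hN₁ D₁ c) * transplant (cS t x₀ hx₀ hfit).W (eS t x₀) (SV hN₁ D₁ c) *
        (transplant (cS t x₀ hx₀ hfit).W (eS t x₀) (GpV hN₁ D₁ c) * transplant (cS t x₀ hx₀ hfit).W (eS t x₀) (GpV hN₁ D₁ c)) *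
        SV hN D c =
      transplant (cS t x₀ hx₀ hfit).W (eS t x₀) (GpV hN₁ D₁ c) * SV hN D c ∧
    transplant (cS t x₀ hx₀ hfit).W (eS t x₀) (GpV hN₁ D₁ c * SV hN₁ D₁ c * GpV hN₁ D₁ c) =
      transplant (cS t x₀ hx₀ hfit).W (eS t x₀) (GpV hN₁ D₁ c) * transplant (cS t x₀ hx₀ hfit).W (eS t x₀) (SV hN₁ D₁ c) *
        transplant (cS t x₀ hx₀ hfit).W (eS t x₀) (GpV hN₁ D₁ c) :=
  ⟨GpV_mul_DpV hN D hℓ hMh hP hc, DpV_mul_GpV hN D hℓ hMh hP hc,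
    mulOp_mul_DpV_mul_transplantGpV hN D hx₀ hfit hN₁ D₁ hlevW hal hk₁ hℓ hMh₁ hP₁ hc χ hχ,
    transplantGpV_mul_DpV_mul_mulOp hN D hx₀ hfit hN₁ D₁ hlevW hal hk₁ hℓ hMh₁ hP₁ hc χ hχ,
    hS1_window hN D hx₀ hfit hN₁ D₁ hlevW hal hk₁ hℓ hMh hP hc c,
    hS2_window hN D hx₀ hfit hN₁ D₁ hlevW hal hℓ hMh₁ hP₁ hc c,
    transplant_GSG hx₀ hfit hN₁ D₁ c⟩

end Blocks

end Literature.MathematicalPhysics.QuantumFieldTheory.Balaban1983to89.B6ScalarAgreeV1Chart
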